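import Literature.Probability.Percolation.FineBlocks
import Literature.Probability.Percolation.ZonesSqOwners
import HarnessLib

/-!
# The gluing zones from blocks: tube region, excised cores, collar layer

Topic `Probability/Percolation`.  Support file (definitions and proofs, no named fact) for the zone
geometry of the proof of Schramm–Smirnov's Prop. 4.1 (Ann. Probab. 39 (2011), §4: the strip `K`
along the neighbourhood of the cut, explored from the far side).  From two finite disjoint sets of
blocks of side `t` — the TUBE REGION `TT` (fresh) and the EXCISED CORES `SQB` (closed squares at the
junctions) — the zones at mesh `δ` are: `SQ` = sites of the cores, `K` = sites of the tube-region
blocks sup-adjacent to a FAR block (a block neither in `TT` nor in `SQB`): the collar, one block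
thick along the boundary of the tube region; `N` = sites of the other tube-region blocks; far = the
rest (`blockZones`).  The geometric niceness required by the tile-data construction and by the owner
count with squares (`TileDataOfZones`, `ZonesSqOwners`) follows from BLOCK-LEVEL hypotheses: the
inner blocks are 4-connected (`NB_conn`), the far blocks are 4-connected (`far_conn`), every core
block is joined through core blocks to one 4-adjacent to a far block (`SQ_far`) and to one
4-adjacent to an inner block (`SQ_inner`).

* `blockZones_nice` (`N_nbr`, `N_conn`, `W_esc`), `blockZones_N_edge`, `blockZones_SQ_esc`,
  `blockZones_far_conn` — the hypotheses of `Zones.exists_owners_zones_sq`.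

## References

* O. Schramm, S. Smirnov, Ann. Probab. 39 (2011), arXiv:1101.5820, §4, proof of Prop. 4.1 (setup
  for the neighbourhood of `α`; the strip `K`; the modification `ω̃`). [SchrammSmirnov2011]
-/

noncomputable section

open Set Relation
open Literature.Probability.LatticeModels
open scoped Classical

namespace Literature.Probability.Percolation

namespace FineBlocks

open CellComplex Seeded

/-! ### Block data -/

/-- **Block data of the zones**: the tube-region blocks and the excised core blocks (finite,
disjoint). [cite: SchrammSmirnov2011, §4, proof of Prop. 4.1 (setup)] -/
structure BlockData where
  /-- the tube region (fresh) -/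
  TT : Finset (ℤ × ℤ)
  /-- the excised cores -/
  SQB : Finset (ℤ × ℤ)
  disj : Disjoint TT SQB

namespace BlockData

variable (B : BlockData)

/-- Far blocks: neither tube region nor core. [folklore] -/
def farB (z : ℤ × ℤ) : Prop := z ∉ B.TT ∧ z ∉ B.SQB

/-- **Collar blocks**: tube-region blocks sup-adjacent to a far block. [cite: SchrammSmirnov2011, §4, proof of Prop. 4.1 (the strip K)] -/
def KB : Finset (ℤ × ℤ) := B.TT.filter fun z => ∃ z', Near z z' ∧ B.farB z'

/-- **Inner blocks**: the other tube-region blocks. [cite: SchrammSmirnov2011, §4, proof of Prop. 4.1 (the neighbourhood of α)] -/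
def NB : Finset (ℤ × ℤ) := B.TT.filter fun z => ¬ ∃ z', Near z z' ∧ B.farB z'

/-- Membership in the collar blocks. [folklore] -/
theorem mem_KB_iff {z : ℤ × ℤ} : z ∈ B.KB ↔ z ∈ B.TT ∧ ∃ z', Near z z' ∧ B.farB z' := by
  rw [KB, Finset.mem_filter]

/-- Membership in the inner blocks. [folklore] -/
theorem mem_NB_iff {z : ℤ × ℤ} : z ∈ B.NB ↔ z ∈ B.TT ∧ ¬ ∃ z', Near z z' ∧ B.farB z' := by
  rw [NB, Finset.mem_filter]

/-- Every block is inner, collar, core or far (exclusively enough). [folklore] -/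
theorem block_cases (z : ℤ × ℤ) : z ∈ B.NB ∨ z ∈ B.KB ∨ z ∈ B.SQB ∨ B.farB z := by
  by_cases hT : z ∈ B.TT
  · by_cases h : ∃ z', Near z z' ∧ B.farB z'
    · exact Or.inr (Or.inl (B.mem_KB_iff.2 ⟨hT, h⟩))
    · exact Or.inl (B.mem_NB_iff.2 ⟨hT, h⟩)
  · by_cases hS : z ∈ B.SQB
    · exact Or.inr (Or.inr (Or.inl hS))
    · exact Or.inr (Or.inr (Or.inr ⟨hT, hS⟩))

end BlockData

/-! ### Site chains from block chains -/

/-- **A 4-chain of blocks inside a block set lifts to a lattice walk inside its sites.**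
[folklore] -/
theorem sites_chain_of_block_chain {t δ : ℝ} (ht : 0 < t) (hδ : 0 < δ) (hδt : δ ≤ t) {S : Set (ℤ × ℤ)} {a b : ℤ × ℤ}
    (hab : ReflTransGen (fun x y => x ∈ S ∧ y ∈ S ∧ OneStep x y) a b) {u v : Site 2}
    (hu : bOf t δ u = a) (hv : bOf t δ v = b) (ha : a ∈ S) :
    ReflTransGen (fun x y : Site 2 => bOf t δ x ∈ S ∧ bOf t δ y ∈ S ∧ (zdGraph 2).Adj x y) u v := by
  -- walks inside one block of `S` are walks of the target relation
  have inside : ∀ {z : ℤ × ℤ} {p q : Site 2}, z ∈ S → p ∈ bOfSites t δ z → q ∈ bOfSites t δ z →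
      ReflTransGen (fun x y : Site 2 => bOf t δ x ∈ S ∧ bOf t δ y ∈ S ∧ (zdGraph 2).Adj x y) p q := by
    intro z p q hz hp hq
    refine reflTransGen_of_imp (fun x y ⟨hx, hy, hxy⟩ => ?_) (bOfSites_connected ht hδ.le hp hq)
    exact ⟨by rw [show bOf t δ x = z from hx]; exact hz, by rw [show bOf t δ y = z from hy]; exact hz, hxy⟩
  -- induction on the block chain, keeping a site of the current block reached from `u`
  have key : ∀ c, ReflTransGen (fun x y => x ∈ S ∧ y ∈ S ∧ OneStep x y) a c → c ∈ S →
      ∀ w : Site 2, bOf t δ w = c →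
        ReflTransGen (fun x y : Site 2 => bOf t δ x ∈ S ∧ bOf t δ y ∈ S ∧ (zdGraph 2).Adj x y) u w := by
    intro c hc
    induction hc with
    | refl =>
      intro haS w hw
      exact inside haS hu hw
    | @tail c d _ hcd ih =>
      intro hdS w hw
      obtain ⟨hcS, -, hstep⟩ := hcd
      obtain ⟨p, q, hpq, hp, hq⟩ := exists_adj_sites_of_oneStep ht hδ hδt hstep
      have h1 := ih hcS p hp
      have h2 : ReflTransGen (fun x y : Site 2 => bOf t δ x ∈ S ∧ bOf t δ y ∈ S ∧ (zdGraph 2).Adj x y) p q :=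
        ReflTransGen.single ⟨by rw [show bOf t δ p = c from hp]; exact hcS, by rw [show bOf t δ q = d from hq]; exact hdS, hpq⟩
      exact (h1.trans h2).trans (inside hdS hq hw)
  have hbS : b ∈ S := by
    induction hab with
    | refl => exact ha
    | tail _ h _ => exact h.2.1
  exact key b hab hbS v hv

/-- The last block of a chain inside a block set is in the set. [folklore] -/
theorem mem_of_block_chain {S : Set (ℤ × ℤ)} {a b : ℤ × ℤ} (hab : ReflTransGen (fun x y => x ∈ S ∧ y ∈ S ∧ OneStep x y) a b)
    (ha : a ∈ S) : b ∈ S := by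
  induction hab with
  | refl => exact ha
  | tail _ h _ => exact h.2.1

/-- A site of a far-out block has large norm: a site whose block has first index `n` has norm
`≥ t n / δ - 1`… precisely `≥ t n / δ` up to the floor. [folklore] -/
theorem norm_large_of_bOf {t δ : ℝ} (ht : 0 < t) (hδ : 0 < δ) {v : Site 2} {n : ℤ} (hv : (bOf t δ v).1 = n) :
    t * n / δ - 1 ≤ ‖Site.toComplex v‖ := by
  have h : ⌊δ * v 0 / t⌋ = n := hv
  rw [Int.floor_eq_iff] at h
  obtain ⟨h1, -⟩ := h
  rw [le_div_iff₀ ht] at h1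
  have hv0 : t * n / δ ≤ v 0 := by rw [div_le_iff₀ hδ]; nlinarith
  have : ((v 0 : ℤ) : ℝ) ≤ ‖Site.toComplex v‖ := by
    have := Complex.abs_re_le_norm (Site.toComplex v)
    rw [Site.toComplex_re] at this
    exact (le_abs_self _).trans this
  linarith

/-- The common face of two lattice neighbours (coordinatewise minimum). [folklore] -/
theorem exists_common_face {u v : Site 2} (h : (zdGraph 2).Adj u v) : ∃ f, TouchesFace u f ∧ TouchesFace v f := by
  obtain ⟨k, rfl⟩ := adj_iff_exists_cornerUnit.1 h
  have hb : ∀ i : Fin 2, |cornerUnit k i| ≤ 1 := by intro i; fin_cases k <;> fin_cases i <;> simp [cornerUnit]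
  refine ⟨fun i => min (u i) (u i + cornerUnit k i), fun i => ?_, fun i => ?_⟩
  · show u i = min (u i) (u i + cornerUnit k i) ∨ u i = min (u i) (u i + cornerUnit k i) + 1
    have := hb i
    rw [abs_le] at this
    rcases le_or_gt 0 (cornerUnit k i) with h | h
    · left; rw [min_eq_left (by omega)]
    · right; rw [min_eq_right (by omega)]; omega
  · show u i + cornerUnit k i = min (u i) (u i + cornerUnit k i) ∨
      u i + cornerUnit k i = min (u i) (u i + cornerUnit k i) + 1
    have := hb i
    rw [abs_le] at this
    rcases le_or_gt (cornerUnit k i) 0 with h | h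
    · left; rw [min_eq_right (by omega)]
    · right; rw [min_eq_left (by omega)]; omega

/-- **Every site has a neighbour in its own block in the second coordinate direction**
(directions `1`/`3`; blocks are two sites wide). [folklore] -/
theorem exists_nbr_same_bOf_vert {t δ : ℝ} (ht : 0 < t) (hδ : 0 < δ) (hδt : 2 * δ ≤ t) (v : Site 2) :
    bOf t δ (v + cornerUnit 1) = bOf t δ v ∨ bOf t δ (v + cornerUnit 3) = bOf t δ v := by
  set x : ℝ := δ * v 1 with hx
  by_cases h : ⌊(x + δ) / t⌋ = ⌊x / t⌋
  · left
    simp only [bOf, coord_add_cornerUnit, Prod.mk.injEq]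
    refine ⟨by simp [cornerUnit], ?_⟩
    have : δ * ((v 1 + cornerUnit 1 1 : ℤ) : ℝ) = x + δ := by simp [cornerUnit, hx]; ring
    rw [this, h]
  · right
    simp only [bOf, coord_add_cornerUnit, Prod.mk.injEq]
    refine ⟨by simp [cornerUnit], ?_⟩
    have e2 : δ * ((v 1 + cornerUnit 3 1 : ℤ) : ℝ) = x - δ := by simp [cornerUnit, hx]; ring
    rw [e2]
    obtain ⟨h1, h2⟩ := floor_step_le ht hδ.le (by linarith) x
    have hup : ⌊(x + δ) / t⌋ = ⌊x / t⌋ + 1 := by omega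
    set n := ⌊x / t⌋ with hn
    have hx1 : ((n + 1 : ℤ) : ℝ) ≤ (x + δ) / t := by rw [← hup]; exact Int.floor_le _
    have hx1' : t * (n + 1) ≤ x + δ := by
      rw [le_div_iff₀ ht] at hx1; push_cast at hx1; linarith
    have hlow : (n : ℝ) ≤ (x - δ) / t := by
      rw [le_div_iff₀ ht]; nlinarith
    have hhigh : (x - δ) / t < n + 1 := by
      have : x / t < n + 1 := by rw [hn]; exact Int.lt_floor_add_one _
      have h' : (x - δ) / t ≤ x / t := div_le_div_of_nonneg_right (by linarith) ht.le
      linarith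
    exact Int.floor_eq_iff.2 ⟨hlow, hhigh⟩

/-- The same in the first coordinate direction (directions `0`/`2`). [folklore] -/
theorem exists_nbr_same_bOf_horiz {t δ : ℝ} (ht : 0 < t) (hδ : 0 < δ) (hδt : 2 * δ ≤ t) (v : Site 2) :
    bOf t δ (v + cornerUnit 0) = bOf t δ v ∨ bOf t δ (v + cornerUnit 2) = bOf t δ v := by
  set x : ℝ := δ * v 0 with hx
  by_cases h : ⌊(x + δ) / t⌋ = ⌊x / t⌋
  · left
    simp only [bOf, coord_add_cornerUnit, Prod.mk.injEq]
    refine ⟨?_, by simp [cornerUnit]⟩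
    have : δ * ((v 0 + cornerUnit 0 0 : ℤ) : ℝ) = x + δ := by simp [cornerUnit, hx]; ring
    rw [this, h]
  · right
    simp only [bOf, coord_add_cornerUnit, Prod.mk.injEq]
    refine ⟨?_, by simp [cornerUnit]⟩
    have e2 : δ * ((v 0 + cornerUnit 2 0 : ℤ) : ℝ) = x - δ := by simp [cornerUnit, hx]; ring
    rw [e2]
    obtain ⟨h1, h2⟩ := floor_step_le ht hδ.le (by linarith) x
    have hup : ⌊(x + δ) / t⌋ = ⌊x / t⌋ + 1 := by omega
    set n := ⌊x / t⌋ with hn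
    have hx1 : ((n + 1 : ℤ) : ℝ) ≤ (x + δ) / t := by rw [← hup]; exact Int.floor_le _
    have hx1' : t * (n + 1) ≤ x + δ := by
      rw [le_div_iff₀ ht] at hx1; push_cast at hx1; linarith
    have hlow : (n : ℝ) ≤ (x - δ) / t := by
      rw [le_div_iff₀ ht]; nlinarith
    have hhigh : (x - δ) / t < n + 1 := by
      have : x / t < n + 1 := by rw [hn]; exact Int.lt_floor_add_one _
      have h' : (x - δ) / t ≤ x / t := div_le_div_of_nonneg_right (by linarith) ht.le
      linarith
    exact Int.floor_eq_iff.2 ⟨hlow, hhigh⟩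

/-- **A perpendicular neighbour in the same block**: for every direction `j` there is a direction
`k ∈ {j + 1, j + 3}` with `v + e_k` in the block of `v`. [folklore] -/
theorem exists_perp_same_bOf {t δ : ℝ} (ht : 0 < t) (hδ : 0 < δ) (hδt : 2 * δ ≤ t) (v : Site 2) (j : Fin 4) :
    ∃ k : Fin 4, (k = j + 1 ∨ k = j + 3) ∧ bOf t δ (v + cornerUnit k) = bOf t δ v := by
  fin_cases j
  · rcases exists_nbr_same_bOf_vert ht hδ hδt v with h | h
    · exact ⟨1, Or.inl rfl, h⟩
    · exact ⟨3, Or.inr rfl, h⟩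
  · rcases exists_nbr_same_bOf_horiz ht hδ hδt v with h | h
    · exact ⟨0, Or.inr rfl, h⟩
    · exact ⟨2, Or.inl rfl, h⟩
  · rcases exists_nbr_same_bOf_vert ht hδ hδt v with h | h
    · exact ⟨1, Or.inr rfl, h⟩
    · exact ⟨3, Or.inl rfl, h⟩
  · rcases exists_nbr_same_bOf_horiz ht hδ hδt v with h | h
    · exact ⟨0, Or.inl rfl, h⟩
    · exact ⟨2, Or.inr rfl, h⟩

namespace BlockData

variable (B : BlockData)

/-- The first coordinates of the non-far blocks are bounded. [folklore] -/
theorem exists_bound_fst : ∃ M : ℤ, ∀ z, (z ∈ B.TT ∨ z ∈ B.SQB) → z.1 < M := by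
  obtain ⟨M, hM⟩ := ((B.TT ∪ B.SQB).image Prod.fst).finite_toSet.bddAbove
  refine ⟨M + 1, fun z hz => ?_⟩
  have : z.1 ∈ (↑((B.TT ∪ B.SQB).image Prod.fst) : Set ℤ) := by
    rw [Finset.coe_image]
    exact ⟨z, by simpa [Finset.mem_union] using hz, rfl⟩
  have := hM this
  omega

/-- **From a far site one walks off to infinity through far sites**, when the far blocks are
4-connected. [folklore] -/
theorem far_escape {t δ : ℝ} (ht : 0 < t) (hδ : 0 < δ) (hδt : δ ≤ t)
    (far_conn : ∀ a b, B.farB a → B.farB b → ReflTransGen (fun x y => B.farB x ∧ B.farB y ∧ OneStep x y) a b)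
    {u : Site 2} (hu : B.farB (bOf t δ u)) (R : ℝ) :
    ∃ u', R < ‖Site.toComplex u'‖ ∧
      ReflTransGen (fun a b : Site 2 => B.farB (bOf t δ a) ∧ B.farB (bOf t δ b) ∧ (zdGraph 2).Adj a b) u u' := by
  obtain ⟨M, hM⟩ := B.exists_bound_fst
  set M' : ℤ := max M (⌈(R + 1) * δ / t⌉ + 1) with hM'
  have hMM' : M ≤ M' := le_max_left _ _
  have hfar : ∀ m : ℤ, B.farB (M', m) := fun m =>
    ⟨fun h => absurd (hM _ (Or.inl h)) (not_lt.2 hMM'), fun h => absurd (hM _ (Or.inr h)) (not_lt.2 hMM')⟩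
  set b : ℤ × ℤ := (M', (bOf t δ u).2) with hb
  obtain ⟨w, hw⟩ := bOfSites_nonempty ht hδ hδt b
  have hchain := sites_chain_of_block_chain (S := {z | B.farB z}) ht hδ hδt (far_conn _ _ hu (hfar _)) rfl hw hu
  refine ⟨w, ?_, hchain⟩
  have h1 := norm_large_of_bOf ht hδ (v := w) (n := M') (by rw [show bOf t δ w = b from hw])
  have h2 : (⌈(R + 1) * δ / t⌉ : ℝ) + 1 ≤ M' := by
    have : (⌈(R + 1) * δ / t⌉ + 1 : ℤ) ≤ M' := le_max_right _ _
    exact_mod_cast this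
  have h3 : (R + 1) * δ / t ≤ ⌈(R + 1) * δ / t⌉ := Int.le_ceil _
  have h4 : t * ((R + 1) * δ / t + 1) / δ - 1 ≤ t * M' / δ - 1 := by
    have : (R + 1) * δ / t + 1 ≤ (M' : ℝ) := by linarith
    have := mul_le_mul_of_nonneg_left this ht.le
    have := div_le_div_of_nonneg_right this hδ.le
    linarith
  have h5 : t * ((R + 1) * δ / t + 1) / δ - 1 = R + t / δ := by
    field_simp
    ring
  have h6 : 0 < t / δ := div_pos ht hδ
  linarith

end BlockData

/-! ### The zones -/

namespace BlockData

variable (B : BlockData) (t δ : ℝ) (ht : 0 < t) (hδ : 0 < δ)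

/-- **The zones of the block data at mesh `δ`.** [cite: SchrammSmirnov2011, §4, proof of Prop. 4.1 (setup for the neighbourhood of α)] -/
def blockZones : Seeded.Zones where
  K := (finite_sites_of_bOf ht hδ (B := (↑B.KB : Set (ℤ × ℤ))) B.KB.finite_toSet).toFinset
  N := (finite_sites_of_bOf ht hδ (B := (↑B.NB : Set (ℤ × ℤ))) B.NB.finite_toSet).toFinset
  SQ := (finite_sites_of_bOf ht hδ (B := (↑B.SQB : Set (ℤ × ℤ))) B.SQB.finite_toSet).toFinset
  disjoint_K_N := by
    rw [Finset.disjoint_left]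
    intro v hK hN
    rw [Set.Finite.mem_toFinset, mem_setOf_eq, Finset.mem_coe] at hK hN
    exact (B.mem_NB_iff.1 hN).2 (B.mem_KB_iff.1 hK).2
  disjoint_K_SQ := by
    rw [Finset.disjoint_left]
    intro v hK hS
    rw [Set.Finite.mem_toFinset, mem_setOf_eq, Finset.mem_coe] at hK hS
    exact Finset.disjoint_left.1 B.disj (B.mem_KB_iff.1 hK).1 hS
  disjoint_N_SQ := by
    rw [Finset.disjoint_left]
    intro v hN hS
    rw [Set.Finite.mem_toFinset, mem_setOf_eq, Finset.mem_coe] at hN hS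
    exact Finset.disjoint_left.1 B.disj (B.mem_NB_iff.1 hN).1 hS

variable {t δ ht hδ}

/-- Membership in `K`. [folklore] -/
theorem mem_K_iff {v : Site 2} : v ∈ (B.blockZones t δ ht hδ).K ↔ bOf t δ v ∈ B.KB := by
  simp [blockZones]

/-- Membership in `N`. [folklore] -/
theorem mem_N_iff {v : Site 2} : v ∈ (B.blockZones t δ ht hδ).N ↔ bOf t δ v ∈ B.NB := by
  simp [blockZones]

/-- Membership in `SQ`. [folklore] -/
theorem mem_SQ_iff {v : Site 2} : v ∈ (B.blockZones t δ ht hδ).SQ ↔ bOf t δ v ∈ B.SQB := by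
  simp [blockZones]

/-- **Far sites are the sites of the far blocks.** [folklore] -/
theorem mem_Far_iff {v : Site 2} : v ∈ (B.blockZones t δ ht hδ).Far ↔ B.farB (bOf t δ v) := by
  rw [Zones.Far, mem_setOf_eq, mem_K_iff, mem_N_iff, mem_SQ_iff, farB]
  constructor
  · rintro ⟨hK, hN, hS⟩
    refine ⟨fun hT => ?_, hS⟩
    by_cases h : ∃ z', Near (bOf t δ v) z' ∧ B.farB z'
    · exact hK (B.mem_KB_iff.2 ⟨hT, h⟩)
    · exact hN (B.mem_NB_iff.2 ⟨hT, h⟩)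
  · rintro ⟨hT, hS⟩
    exact ⟨fun h => hT (B.mem_KB_iff.1 h).1, fun h => hT (B.mem_NB_iff.1 h).1, hS⟩

/-- Sites of the tube region are window sites. [folklore] -/
theorem mem_Wv_of_mem_TT {v : Site 2} (hv : bOf t δ v ∈ B.TT) : v ∈ (B.blockZones t δ ht hδ).Wv := by
  by_cases h : ∃ z', Near (bOf t δ v) z' ∧ B.farB z'
  · exact Or.inl (B.mem_K_iff.2 (B.mem_KB_iff.2 ⟨hv, h⟩))
  · exact Or.inr (B.mem_N_iff.2 (B.mem_NB_iff.2 ⟨hv, h⟩))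

/-- Window sites are sites of the tube region. [folklore] -/
theorem mem_TT_of_mem_Wv {v : Site 2} (hv : v ∈ (B.blockZones t δ ht hδ).Wv) : bOf t δ v ∈ B.TT := by
  rcases hv with h | h
  · exact (B.mem_KB_iff.1 (B.mem_K_iff.1 h)).1
  · exact (B.mem_NB_iff.1 (B.mem_N_iff.1 h)).1

/-! ### Niceness -/

section Nice

variable (hδt : 2 * δ ≤ t)
  (NB_conn : ∀ a ∈ B.NB, ∀ b ∈ B.NB, ReflTransGen (fun x y => x ∈ B.NB ∧ y ∈ B.NB ∧ OneStep x y) a b)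
  (far_conn : ∀ a b, B.farB a → B.farB b → ReflTransGen (fun x y => B.farB x ∧ B.farB y ∧ OneStep x y) a b)
  (SQ_far : ∀ q ∈ B.SQB, ∃ q' z, ReflTransGen (fun x y => x ∈ B.SQB ∧ y ∈ B.SQB ∧ OneStep x y) q q' ∧
    OneStep q' z ∧ B.farB z)
  (SQ_inner : ∀ q ∈ B.SQB, ∃ q' z, ReflTransGen (fun x y => x ∈ B.SQB ∧ y ∈ B.SQB ∧ OneStep x y) q q' ∧
    OneStep q' z ∧ z ∈ B.NB)

include hδt in
/-- **Tube sites have no far neighbours.** [folklore] -/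
theorem blockZones_N_nbr : ∀ v ∈ (B.blockZones t δ ht hδ).N, ∀ k : Fin 4,
    v + cornerUnit k ∈ (B.blockZones t δ ht hδ).K ∨ v + cornerUnit k ∈ (B.blockZones t δ ht hδ).N ∨
      v + cornerUnit k ∈ (B.blockZones t δ ht hδ).SQ := by
  intro v hv k
  have hvN := B.mem_N_iff.1 hv
  have hnear : Near (bOf t δ v) (bOf t δ (v + cornerUnit k)) :=
    near_bOf_of_adj ht hδ (by linarith) (adj_iff_exists_cornerUnit.2 ⟨k, rfl⟩)
  have hnotfar : ¬ B.farB (bOf t δ (v + cornerUnit k)) := fun hf =>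
    (B.mem_NB_iff.1 hvN).2 ⟨_, hnear, hf⟩
  rcases B.block_cases (bOf t δ (v + cornerUnit k)) with h | h | h | h
  · exact Or.inr (Or.inl (B.mem_N_iff.2 h))
  · exact Or.inl (B.mem_K_iff.2 h)
  · exact Or.inr (Or.inr (B.mem_SQ_iff.2 h))
  · exact absurd h hnotfar

include hδt NB_conn in
/-- **The tube is connected.** [folklore] -/
theorem blockZones_N_conn : ∀ u ∈ (B.blockZones t δ ht hδ).N, ∀ v ∈ (B.blockZones t δ ht hδ).N,
    ReflTransGen (fun a b => a ∈ (B.blockZones t δ ht hδ).N ∧ b ∈ (B.blockZones t δ ht hδ).N ∧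
      ∃ k : Fin 4, b = a + cornerUnit k) u v := by
  intro u hu v hv
  have huN := B.mem_N_iff.1 hu
  have hvN := B.mem_N_iff.1 hv
  have h := sites_chain_of_block_chain (S := (↑B.NB : Set (ℤ × ℤ))) ht hδ (by linarith)
    (reflTransGen_of_imp (fun x y ⟨hx, hy, hxy⟩ => ⟨Finset.mem_coe.2 hx, Finset.mem_coe.2 hy, hxy⟩) (NB_conn _ huN _ hvN))
    rfl rfl (Finset.mem_coe.2 huN)
  refine reflTransGen_of_imp (fun x y ⟨hx, hy, hxy⟩ => ⟨B.mem_N_iff.2 hx, B.mem_N_iff.2 hy, ?_⟩) h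
  exact adj_iff_exists_cornerUnit.1 hxy

include hδt far_conn SQ_far in
/-- **The outside of the window is walkable to infinity.** [folklore] -/
theorem blockZones_W_esc : ∀ u, u ∉ (B.blockZones t δ ht hδ).K → u ∉ (B.blockZones t δ ht hδ).N → ∀ R : ℝ,
    ∃ u', R < ‖Site.toComplex u'‖ ∧
      ReflTransGen (fun a b => (a ∉ (B.blockZones t δ ht hδ).K ∧ a ∉ (B.blockZones t δ ht hδ).N) ∧
        (b ∉ (B.blockZones t δ ht hδ).K ∧ b ∉ (B.blockZones t δ ht hδ).N) ∧ ∃ k : Fin 4, b = a + cornerUnit k) u u' := by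
  intro u huK huN R
  have huT : bOf t δ u ∉ B.TT := fun h => by
    rcases B.mem_Wv_of_mem_TT (ht := ht) (hδ := hδ) h with h' | h'
    · exact huK h'
    · exact huN h'
  have lift : ∀ {a b : Site 2}, ReflTransGen (fun x y : Site 2 => bOf t δ x ∉ B.TT ∧ bOf t δ y ∉ B.TT ∧ (zdGraph 2).Adj x y) a b →
      ReflTransGen (fun a b => (a ∉ (B.blockZones t δ ht hδ).K ∧ a ∉ (B.blockZones t δ ht hδ).N) ∧
        (b ∉ (B.blockZones t δ ht hδ).K ∧ b ∉ (B.blockZones t δ ht hδ).N) ∧ ∃ k : Fin 4, b = a + cornerUnit k) a b := by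
    intro a b h
    refine reflTransGen_of_imp (fun x y ⟨hx, hy, hxy⟩ => ⟨⟨fun h' => hx ?_, fun h' => hx ?_⟩, ⟨fun h' => hy ?_, fun h' => hy ?_⟩,
      adj_iff_exists_cornerUnit.1 hxy⟩) h
    · exact B.mem_TT_of_mem_Wv (Or.inl h')
    · exact B.mem_TT_of_mem_Wv (Or.inr h')
    · exact B.mem_TT_of_mem_Wv (Or.inl h')
    · exact B.mem_TT_of_mem_Wv (Or.inr h')
  have reach : ∃ u₁, B.farB (bOf t δ u₁) ∧
      ReflTransGen (fun x y : Site 2 => bOf t δ x ∉ B.TT ∧ bOf t δ y ∉ B.TT ∧ (zdGraph 2).Adj x y) u u₁ := by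
    by_cases huS : bOf t δ u ∈ B.SQB
    · obtain ⟨q', z, hqq', hq'z, hz⟩ := SQ_far _ huS
      obtain ⟨p, q, hpq, hp, hq⟩ := exists_adj_sites_of_oneStep ht hδ (by linarith) hq'z
      have h1 := sites_chain_of_block_chain (S := (↑B.SQB : Set (ℤ × ℤ))) ht hδ (by linarith)
        (reflTransGen_of_imp (fun x y ⟨hx, hy, hxy⟩ => ⟨Finset.mem_coe.2 hx, Finset.mem_coe.2 hy, hxy⟩) hqq')
        rfl hp (Finset.mem_coe.2 huS)
      refine ⟨q, by rw [show bOf t δ q = z from hq]; exact hz, ?_⟩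
      have notT : ∀ {x : Site 2}, bOf t δ x ∈ (↑B.SQB : Set (ℤ × ℤ)) → bOf t δ x ∉ B.TT := fun hx h =>
        Finset.disjoint_left.1 B.disj h (Finset.mem_coe.1 hx)
      have hq'S : q' ∈ B.SQB := mem_of_block_chain hqq' huS |> fun h => h
      refine (reflTransGen_of_imp (fun x y ⟨hx, hy, hxy⟩ => ⟨notT hx, notT hy, hxy⟩) h1).tail ⟨?_, ?_, hpq⟩
      · exact notT (by rw [show bOf t δ p = q' from hp]; exact Finset.mem_coe.2 hq'S)
      · rw [show bOf t δ q = z from hq]; exact hz.1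
    · exact ⟨u, ⟨huT, huS⟩, ReflTransGen.refl⟩
  obtain ⟨u₁, hu₁, hwalk₁⟩ := reach
  obtain ⟨u', hR, hwalk₂⟩ := B.far_escape ht hδ (by linarith) far_conn hu₁ R
  refine ⟨u', hR, lift (hwalk₁.trans (reflTransGen_of_imp (fun x y ⟨hx, hy, hxy⟩ => ⟨hx.1, hy.1, hxy⟩) hwalk₂))⟩

include hδt NB_conn far_conn SQ_far in
/-- **The block zones are nice.** [cite: SchrammSmirnov2011, §4, proof of Prop. 4.1 (setup)] -/
theorem blockZones_nice : (B.blockZones t δ ht hδ).Nice where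
  N_nbr := B.blockZones_N_nbr hδt
  N_conn := B.blockZones_N_conn hδt NB_conn
  W_esc := B.blockZones_W_esc hδt far_conn SQ_far

include hδt in
/-- **Every tube site has a non-square neighbour** (one in its own block). [folklore] -/
theorem blockZones_N_edge : ∀ n ∈ (B.blockZones t δ ht hδ).N, ∃ k : Fin 4, n + cornerUnit k ∉ (B.blockZones t δ ht hδ).SQ := by
  intro n hn
  obtain ⟨k, hk⟩ := exists_nbr_same_bOf ht hδ hδt n
  refine ⟨k, fun h => ?_⟩
  have h1 := B.mem_SQ_iff.1 h
  rw [hk] at h1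
  exact Finset.disjoint_left.1 B.disj (B.mem_NB_iff.1 (B.mem_N_iff.1 hn)).1 h1

include hδt far_conn in
/-- **The far sites are pairwise joined through far sites** (one far component). [folklore] -/
theorem blockZones_far_conn : ∀ u ∈ (B.blockZones t δ ht hδ).Far, ∀ u' ∈ (B.blockZones t δ ht hδ).Far,
    ReflTransGen (fun a b => a ∈ (B.blockZones t δ ht hδ).Far ∧ b ∈ (B.blockZones t δ ht hδ).Far ∧ (zdGraph 2).Adj a b) u u' := by
  intro u hu u' hu'
  have huF := B.mem_Far_iff.1 hu
  have hu'F := B.mem_Far_iff.1 hu'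
  have h := sites_chain_of_block_chain (S := {z | B.farB z}) ht hδ (by linarith) (far_conn _ _ huF hu'F) rfl rfl huF
  exact reflTransGen_of_imp (fun x y ⟨hx, hy, hxy⟩ => ⟨B.mem_Far_iff.2 hx, B.mem_Far_iff.2 hy, hxy⟩) h

/-- **A face at a tube site next to a square site has a tube-edge side**: some face touching
`n + e_j` has a side which is a tube edge (the edge from the tube site `n` to a perpendicular
neighbour in its own block). [folklore] -/
theorem exists_face_tubeEdge (hδt : 2 * δ ≤ t) {n : Site 2} (j : Fin 4) (hn : n ∈ (B.blockZones t δ ht hδ).N) :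
    ∃ g, TouchesFace (n + cornerUnit j) g ∧ ∃ e ∈ (B.blockZones t δ ht hδ).tubeEdges, IsFaceOf g e := by
  obtain ⟨k, hk, hkb⟩ := exists_perp_same_bOf ht hδ hδt n j
  have hn'N : n + cornerUnit k ∈ (B.blockZones t δ ht hδ).N := B.mem_N_iff.2 (by rw [hkb]; exact B.mem_N_iff.1 hn)
  have notSQ : ∀ w ∈ (B.blockZones t δ ht hδ).N, w ∉ (B.blockZones t δ ht hδ).SQ := fun w hw hS =>
    Finset.disjoint_left.1 (B.blockZones t δ ht hδ).disjoint_N_SQ hw hS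
  have he : dartEdge n k ∈ (B.blockZones t δ ht hδ).tubeEdges := by
    refine (B.blockZones t δ ht hδ).mem_tubeEdges_iff.2 ⟨dartEdge_mem_edgeSet _ _, ⟨n, mem_dartEdge_iff.2 (Or.inl rfl), hn⟩,
      fun v hv => ?_⟩
    rcases mem_dartEdge_iff.1 hv with rfl | rfl
    · exact notSQ _ hn
    · exact notSQ _ hn'N
  have touch : ∀ m : Fin 4, (m = j ∨ m = j + 3) → TouchesFace (n + cornerUnit j) (faceAt n m) := by
    rintro m hm
    have hf : IsFaceOf (faceAt n m) (dartEdge n j) := by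
      rcases hm with rfl | rfl
      · exact isFaceOf_dartEdge_iff.2 (Or.inl rfl)
      · exact isFaceOf_dartEdge_iff.2 (Or.inr rfl)
    exact touchesFace_of_isFaceOf (dartEdge_mem_edgeSet _ _) hf (mem_dartEdge_iff.2 (Or.inr rfl))
  rcases hk with rfl | rfl
  · refine ⟨faceAt n ((j + 1) + 3), touch _ (Or.inl ?_), dartEdge n (j + 1), he, isFaceOf_dartEdge_iff.2 (Or.inr rfl)⟩
    rw [add_assoc, show (1 : Fin 4) + 3 = 0 from rfl, add_zero]
  · exact ⟨faceAt n (j + 3), touch _ (Or.inr rfl), dartEdge n (j + 3), he, isFaceOf_dartEdge_iff.2 (Or.inl rfl)⟩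

include hδt SQ_inner in
/-- **From every square corner of a face one reaches, through faces sharing square corners, a face
with a tube-edge side.** [folklore] -/
theorem blockZones_SQ_esc : ∀ q ∈ (B.blockZones t δ ht hδ).SQ, ∀ f, TouchesFace q f →
    ∃ g, (∃ e ∈ (B.blockZones t δ ht hδ).tubeEdges, IsFaceOf g e) ∧
      ReflTransGen (fun a b => ∃ u, TouchesFace u a ∧ TouchesFace u b ∧ u ∈ (B.blockZones t δ ht hδ).SQ) f g := by
  intro q hq f hqf
  have hqB := B.mem_SQ_iff.1 hq
  obtain ⟨q', z, hqq', hq'z, hz⟩ := SQ_inner _ hqB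
  obtain ⟨p, nn, hpn, hp, hnn⟩ := exists_adj_sites_of_oneStep ht hδ (by linarith) hq'z
  have hnnN : nn ∈ (B.blockZones t δ ht hδ).N := B.mem_N_iff.2 (by rw [show bOf t δ nn = z from hnn]; exact hz)
  have hwalk := sites_chain_of_block_chain (S := (↑B.SQB : Set (ℤ × ℤ))) ht hδ (by linarith)
    (reflTransGen_of_imp (fun x y ⟨hx, hy, hxy⟩ => ⟨Finset.mem_coe.2 hx, Finset.mem_coe.2 hy, hxy⟩) hqq') rfl hp
    (Finset.mem_coe.2 hqB)
  -- every face at the current square site of the walk is reached from `f`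
  have claim : ∀ w, ReflTransGen (fun x y : Site 2 => bOf t δ x ∈ (↑B.SQB : Set (ℤ × ℤ)) ∧
      bOf t δ y ∈ (↑B.SQB : Set (ℤ × ℤ)) ∧ (zdGraph 2).Adj x y) q w → w ∈ (B.blockZones t δ ht hδ).SQ →
      ∀ φ, TouchesFace w φ →
        ReflTransGen (fun a b => ∃ u, TouchesFace u a ∧ TouchesFace u b ∧ u ∈ (B.blockZones t δ ht hδ).SQ) f φ := by
    intro w hw
    induction hw with
    | refl =>
      intro hwS φ hφ
      exact ReflTransGen.single ⟨q, hqf, hφ, hwS⟩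
    | @tail w w' _ hst ih =>
      intro hw'S φ hφ
      obtain ⟨hwB, -, hadj⟩ := hst
      obtain ⟨c, hwc, hw'c⟩ := exists_common_face hadj
      have hwS : w ∈ (B.blockZones t δ ht hδ).SQ := B.mem_SQ_iff.2 (Finset.mem_coe.1 hwB)
      exact (ih hwS c hwc).tail ⟨w', hw'c, hφ, hw'S⟩
  have hpS : p ∈ (B.blockZones t δ ht hδ).SQ :=
    B.mem_SQ_iff.2 (by rw [show bOf t δ p = q' from hp]; exact mem_of_block_chain hqq' hqB)
  obtain ⟨j, hj⟩ := adj_iff_exists_cornerUnit.1 hpn.symm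
  obtain ⟨g, hg, e, he, hge⟩ := B.exists_face_tubeEdge hδt j hnnN
  rw [← hj] at hg
  exact ⟨g, ⟨e, he, hge⟩, claim p hwalk hpS g hg⟩

end Nice

/-- **The owners of the hub contacts are few** for the block zones (the owner count of
`ZonesSqOwners` with its geometric hypotheses discharged). [cite: SchrammSmirnov2011, §4, proof of Prop. 4.1 ("the number of bays is bounded")] -/
theorem exists_owners_blockZones (hδt : 2 * δ ≤ t)
    (far_conn : ∀ a b, B.farB a → B.farB b → ReflTransGen (fun x y => B.farB x ∧ B.farB y ∧ OneStep x y) a b)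
    (SQ_inner : ∀ q ∈ B.SQB, ∃ q' z, ReflTransGen (fun x y => x ∈ B.SQB ∧ y ∈ B.SQB ∧ OneStep x y) q q' ∧
      OneStep q' z ∧ z ∈ B.NB)
    (hN : (B.blockZones t δ ht hδ).Nice)
    {X : Finset (Sym2 (Site 2))} {ω : BondConfig (Site 2)} (hT : Seeded.IsTerminal (B.blockZones t δ ht hδ).seeds X ω)
    {d₀ : Site 2 × Fin 4} (h₀ : IsBd ((B.blockZones t δ ht hδ).tileData hT hN).U d₀) :
    ∃ R : Finset (Site 2), R.card ≤ max 1 (2 * (((B.blockZones t δ ht hδ).tileData hT hN).landings).card +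
        (((B.blockZones t δ ht hδ).tileData hT hN).sqSides d₀ (↑(B.blockZones t δ ht hδ).SQ : Set (Site 2)) h₀).card) ∧
      ∀ i, ((B.blockZones t δ ht hδ).tileData hT hN).hubContact d₀ i →
        ∀ v ∈ ((B.blockZones t δ ht hδ).tileData hT hN).att (((B.blockZones t δ ht hδ).tileData hT hN).outCell d₀ i),
          ∃ r ∈ R, ((B.blockZones t δ ht hδ).tileData hT hN).HubConn v r :=
  (B.blockZones t δ ht hδ).exists_owners_zones_sq hT hN (B.blockZones_N_edge hδt)
    (B.blockZones_SQ_esc hδt SQ_inner) (B.blockZones_far_conn hδt far_conn) h₀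

end BlockData

end FineBlocks

end Literature.Probability.Percolation

end
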